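/-
Copyright (c) 2026 the pub-hodgecm-mathlib formalisation cell (harness21).  Prover seat hodgecm-mathlib-A-p19 (g21), D-T road (Tamagawa ∕ (K7-s)),
brick B2b «D-T3′-def, the archimedean singular centraliser: range, Haar property, frame independence» (LEAD F0P3a-plan (g9) WORDS T8-6 ∕ T8-16 (D), 2026-09-01).
-/
import Literature.NumberTheory.Weil1964.UnitaryArchSingularCentralizerTopFormHaar
import Literature.NumberTheory.Automorphic.UnitaryGroupSingularCentralizerDock
import Literature.NumberTheory.Automorphic.UnitaryGroupFormCongrFinSum
import Mathlib.LinearAlgebra.Matrix.Charpoly.Basic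
import HarnessLib

/-!
# The archimedean centraliser of a singular semisimple element: `Z(γ) = T (U(H_a) × U(H_b))(L⁺ ⊗ ℝ) T⁻¹`, its top-form Haar measure, and frame independence
# (Rogawski 1990 §3.8 Prop. 3.8.1 (a), §1.7 p. 6; Hewitt–Ross (5.29); Helgason 2000 Ch. I §1)

Topic `NumberTheory/Weil1964`; namespace `Literature.NumberTheory.Weil1964.UnitaryArchTopForm`.  THEOREMS ONLY (no definition, no instance, no notation, no named fact,
no `sorry`) over ★ B2a `UnitaryArchSingularCentralizerTopFormHaar` (defs `archBlockDiag`, `archFrameEmbedding`, `centralizerMeasureOfFrame`, `IsSingularArchFrame`,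
`centralizerTopFormHaar`), ★ B1″ part C `UnitaryArchTopFormHaarCongr` (`map_archCongr_archTopFormHaar_of_isCM`), ★ `UnitaryGroupBlockCentralizer`
(`mem_range_blockDiagFin_iff_commute`, `eq_finSum_of_commute`), ★ `UnitaryGroupFormCongrFinSum` (`formCongr_mul_eq`, `formCongr_reindexGL_blockDiagGL_finSum`) and ★
`UnitaryGroupSingularCentralizerDock` §1 (`exists_continuousMulEquiv_coe_eq_of_injective`); Mathlib `Matrix.charpoly_units_conj'`, `Measure.map_prod_map`.
Cell `pub/hodgecm-mathlib`, crux H413 = `stmt-HodgeConjecture-24833`; D-T road row «D-T3′», brick B2b (census `CENSUS-B2-ArchSingularCentralizerTopFormHaar` 2aaa130ebe3bf25a §2–§4).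

* §1 (generic `F E c`, sizes `N₁ + N₂`) **`range_archFrameEmbedding_eq_centralizer`** (`Z(γ) = T (U(J₁) × U(J₂)) T⁻¹` for `γ T = T (a·1 ⊕ᶠ b·1)`, `a − b` a unit),
  **`exists_continuousMulEquiv_centralizer_of_frame`** (`Z(γ) ≃ₜ* U(J₁) × U(J₂)` WITH the formula; open mapping theorem),
  **`isHaarMeasure_centralizerMeasureOfFrame`** (Haar blocks ⇒ Haar frame measure).
* §2 (any commutative ring) `exists_eq_reindexGL_blockDiagGL_of_commute` (a UNIT commuting with `a·1 ⊕ᶠ b·1` is a block diagonal of units).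
* §3 (any field) `eq_of_finSum_smul_one_mul_eq` (conjugate `(2,1)`-block scalars have the same eigenvalue pair; characteristic polynomials).
* §4 (CM) `IsSingularArchFrame.isUnit_sub` ∕ `.formCongr_eq` ∕ `.mul_eq` ∕ `.finSum_mul_inv_mul` ∕ **`.eigen_eq`** ∕ **`.exists_blocks`** (two frames differ by a block
  congruence `g₁ ⊕ g₂` carrying `H_a′ ↦ H_{a′}′`, `H_b′ ↦ H_{b′}′`), `archFrameEmbedding_mul_blockDiag`, **`centralizerMeasureOfFrame_eq_of_isSingularArchFrame`** (FRAME
  INDEPENDENCE), **`centralizerTopFormHaar_eq_centralizerMeasureOfFrame`** (the definition computed in ANY frame), **`isHaarMeasure_centralizerTopFormHaar`**,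
  `centralizerTopFormHaar_of_not_exists`.
HONEST SCOPE.  Group theory and measure transport; no volume is computed.  HC_CM is proved only modulo the printed citations until rung 0 closes; this file discharges no
printed statement.

## References
* J. D. Rogawski, *Automorphic Representations of Unitary Groups in Three Variables*, Ann. of Math. Stud. 123 (1990), §1.7 p. 6, §3.8 Prop. 3.8.1 (a) p. 27. [Rogawski1990]
* E. Hewitt, K. A. Ross, *Abstract Harmonic Analysis I*, 2nd ed. (1979), Thm. (5.29) (open mapping theorem). [HewittRoss1979]
* S. Helgason, *Groups and Geometric Analysis*, AMS Math. Surveys Monogr. 83 (2000), Ch. I §1 Thm. 1.14 p. 96. [Helgason2000]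
-/

set_option autoImplicit false

noncomputable section

open NumberField NumberField.mixedEmbedding NumberField.InfinitePlace Set Filter Topology MeasureTheory MeasureTheory.Measure
open Literature.NumberTheory.Automorphic Literature.NumberTheory.Automorphic.UnitaryGroup
open scoped Classical Matrix MatrixGroups ENNReal NNReal

namespace Literature.NumberTheory.Weil1964

namespace UnitaryArchTopForm

/-! ## §1 The range of the frame embedding, the isomorphism with the centraliser, the Haar property -/

section Frame

variable (F E : Type) [Field F] [Field E] [Algebra F E] (c : E ≃ₐ[F] E) {N₁ N₂ : ℕ}
  {J : Matrix (Fin (N₁ + N₂)) (Fin (N₁ + N₂)) E} {J₁ : Matrix (Fin N₁) (Fin N₁) E} {J₂ : Matrix (Fin N₂) (Fin N₂) E}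

variable {F E c}

/-- **THE RANGE OF THE FRAME EMBEDDING IS THE CENTRALISER of `γ = T (a·1 ⊕ᶠ b·1) T⁻¹`** when `a − b` is a unit of `E ⊗ ℝ` (★ `mem_range_blockDiagFin_iff_commute`
transported by the congruence): `Z(γ) = T (U(J₁) × U(J₂))(E ⊗ ℝ) T⁻¹`. [cite: Rogawski1990, §3.8 Prop. 3.8.1 (a) p. 27] -/
theorem range_archFrameEmbedding_eq_centralizer (T : GL (Fin (N₁ + N₂)) (mixedSpace E))
    (hT : formCongr (conjMixed F E c) T (archFormOf E (N₁ + N₂) J) = archFormOf E (N₁ + N₂) (finSum N₁ N₂ J₁ J₂)) {a b : mixedSpace E} (hab : IsUnit (a - b))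
    (γ : arch F E c (N₁ + N₂) J)
    (hγ : ((γ : GL (Fin (N₁ + N₂)) (mixedSpace E)) : Matrix (Fin (N₁ + N₂)) (Fin (N₁ + N₂)) (mixedSpace E)) * (T : Matrix (Fin (N₁ + N₂)) (Fin (N₁ + N₂)) (mixedSpace E)) =
      (T : Matrix (Fin (N₁ + N₂)) (Fin (N₁ + N₂)) (mixedSpace E)) * finSum N₁ N₂ (a • (1 : Matrix (Fin N₁) (Fin N₁) (mixedSpace E))) (b • 1)) :
    (archFrameEmbedding T hT).range = Subgroup.centralizer ({γ} : Set (arch F E c (N₁ + N₂) J)) := by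
  ext g
  constructor
  · rintro ⟨u, rfl⟩
    exact archFrameEmbedding_mem_centralizer T hT γ hγ u
  · intro hg
    set Φ := unitaryGroupOfFormCongrOfEq (conjMixed F E c) T (archFormOf E (N₁ + N₂) J) (archFormOf E (N₁ + N₂) (finSum N₁ N₂ J₁ J₂)) hT with hΦ
    set Tm : Matrix (Fin (N₁ + N₂)) (Fin (N₁ + N₂)) (mixedSpace E) := (T : Matrix (Fin (N₁ + N₂)) (Fin (N₁ + N₂)) (mixedSpace E)) with hTm
    set Ti : Matrix (Fin (N₁ + N₂)) (Fin (N₁ + N₂)) (mixedSpace E) := ((T⁻¹ : GL (Fin (N₁ + N₂)) (mixedSpace E)) : Matrix (Fin (N₁ + N₂)) (Fin (N₁ + N₂)) (mixedSpace E))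
      with hTi
    have hTT : Tm * Ti = 1 := by rw [hTm, hTi, ← Units.val_mul, mul_inv_cancel, Units.val_one]
    have hTT' : Ti * Tm = 1 := by rw [hTm, hTi, ← Units.val_mul, inv_mul_cancel, Units.val_one]
    set D := finSum N₁ N₂ (a • (1 : Matrix (Fin N₁) (Fin N₁) (mixedSpace E))) (b • 1) with hD
    -- `g′ := T⁻¹ g T ∈ U((J₁ ⊕ᶠ J₂)′)` commutes with `D`
    set g' : unitaryGroupOfForm (conjMixed F E c) (finSum N₁ N₂ (archFormOf E N₁ J₁) (archFormOf E N₂ J₂)) :=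
      Subgroup.inclusion (arch_finSum_le F E c J₁ J₂) (Φ.symm g) with hg'
    have hg'coe : ((g' : GL (Fin (N₁ + N₂)) (mixedSpace E)) : Matrix (Fin (N₁ + N₂)) (Fin (N₁ + N₂)) (mixedSpace E)) =
        Ti * ((g : GL (Fin (N₁ + N₂)) (mixedSpace E)) : Matrix (Fin (N₁ + N₂)) (Fin (N₁ + N₂)) (mixedSpace E)) * Tm := by
      rw [hg', Subgroup.coe_inclusion, hΦ, coe_unitaryGroupOfFormCongrOfEq_symm_apply, Units.val_mul, Units.val_mul]
    have hγ' : ((γ : GL (Fin (N₁ + N₂)) (mixedSpace E)) : Matrix (Fin (N₁ + N₂)) (Fin (N₁ + N₂)) (mixedSpace E)) = Tm * D * Ti := by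
      rw [← hγ, Matrix.mul_assoc, hTT, Matrix.mul_one]
    have hcomm : ((γ : GL (Fin (N₁ + N₂)) (mixedSpace E)) : Matrix (Fin (N₁ + N₂)) (Fin (N₁ + N₂)) (mixedSpace E)) *
        ((g : GL (Fin (N₁ + N₂)) (mixedSpace E)) : Matrix (Fin (N₁ + N₂)) (Fin (N₁ + N₂)) (mixedSpace E)) =
        ((g : GL (Fin (N₁ + N₂)) (mixedSpace E)) : Matrix (Fin (N₁ + N₂)) (Fin (N₁ + N₂)) (mixedSpace E)) *
        ((γ : GL (Fin (N₁ + N₂)) (mixedSpace E)) : Matrix (Fin (N₁ + N₂)) (Fin (N₁ + N₂)) (mixedSpace E)) := by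
      have h := (Subgroup.mem_centralizer_iff.1 hg) γ rfl
      have h' := congrArg (fun k : arch F E c (N₁ + N₂) J => ((k : GL (Fin (N₁ + N₂)) (mixedSpace E)) : Matrix (Fin (N₁ + N₂)) (Fin (N₁ + N₂)) (mixedSpace E))) h
      simpa only [Subgroup.coe_mul, Units.val_mul] using h'
    have hg'D : ((g' : GL (Fin (N₁ + N₂)) (mixedSpace E)) : Matrix (Fin (N₁ + N₂)) (Fin (N₁ + N₂)) (mixedSpace E)) * D =
        D * ((g' : GL (Fin (N₁ + N₂)) (mixedSpace E)) : Matrix (Fin (N₁ + N₂)) (Fin (N₁ + N₂)) (mixedSpace E)) := by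
      rw [hg'coe]
      rw [hγ'] at hcomm
      -- `Tm D Ti g = g Tm D Ti` ⇒ `D (Ti g Tm) = (Ti g Tm) D`
      have h : Ti * (Tm * D * Ti * ((g : GL (Fin (N₁ + N₂)) (mixedSpace E)) : Matrix (Fin (N₁ + N₂)) (Fin (N₁ + N₂)) (mixedSpace E))) * Tm =
          Ti * (((g : GL (Fin (N₁ + N₂)) (mixedSpace E)) : Matrix (Fin (N₁ + N₂)) (Fin (N₁ + N₂)) (mixedSpace E)) * (Tm * D * Ti)) * Tm := by
        rw [hcomm]
      have e1 : Ti * (Tm * D * Ti * ((g : GL (Fin (N₁ + N₂)) (mixedSpace E)) : Matrix (Fin (N₁ + N₂)) (Fin (N₁ + N₂)) (mixedSpace E))) * Tm =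
          D * (Ti * ((g : GL (Fin (N₁ + N₂)) (mixedSpace E)) : Matrix (Fin (N₁ + N₂)) (Fin (N₁ + N₂)) (mixedSpace E)) * Tm) := by
        calc Ti * (Tm * D * Ti * ((g : GL (Fin (N₁ + N₂)) (mixedSpace E)) : Matrix (Fin (N₁ + N₂)) (Fin (N₁ + N₂)) (mixedSpace E))) * Tm
            = (Ti * Tm) * D * Ti * ((g : GL (Fin (N₁ + N₂)) (mixedSpace E)) : Matrix (Fin (N₁ + N₂)) (Fin (N₁ + N₂)) (mixedSpace E)) * Tm := by
              simp only [Matrix.mul_assoc]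
          _ = D * (Ti * ((g : GL (Fin (N₁ + N₂)) (mixedSpace E)) : Matrix (Fin (N₁ + N₂)) (Fin (N₁ + N₂)) (mixedSpace E)) * Tm) := by
              rw [hTT', Matrix.one_mul]; simp only [Matrix.mul_assoc]
      have e2 : Ti * (((g : GL (Fin (N₁ + N₂)) (mixedSpace E)) : Matrix (Fin (N₁ + N₂)) (Fin (N₁ + N₂)) (mixedSpace E)) * (Tm * D * Ti)) * Tm =
          Ti * ((g : GL (Fin (N₁ + N₂)) (mixedSpace E)) : Matrix (Fin (N₁ + N₂)) (Fin (N₁ + N₂)) (mixedSpace E)) * Tm * D := by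
        calc Ti * (((g : GL (Fin (N₁ + N₂)) (mixedSpace E)) : Matrix (Fin (N₁ + N₂)) (Fin (N₁ + N₂)) (mixedSpace E)) * (Tm * D * Ti)) * Tm
            = Ti * ((g : GL (Fin (N₁ + N₂)) (mixedSpace E)) : Matrix (Fin (N₁ + N₂)) (Fin (N₁ + N₂)) (mixedSpace E)) * Tm * D * (Ti * Tm) := by
              simp only [Matrix.mul_assoc]
          _ = Ti * ((g : GL (Fin (N₁ + N₂)) (mixedSpace E)) : Matrix (Fin (N₁ + N₂)) (Fin (N₁ + N₂)) (mixedSpace E)) * Tm * D := by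
              rw [hTT', Matrix.mul_one]
      rw [e1, e2] at h
      exact h.symm
    -- hence `g′` is block diagonal
    obtain ⟨u, hu⟩ := (mem_range_blockDiagFin_iff_commute (conjMixed F E c) (archFormOf E N₁ J₁) (archFormOf E N₂ J₂) hab g').2 hg'D
    refine ⟨u, ?_⟩
    -- `T u T⁻¹ = g`
    apply Subtype.ext
    rw [coe_archFrameEmbedding]
    have hu' : ((archBlockDiag F E c J₁ J₂ u : arch F E c (N₁ + N₂) (finSum N₁ N₂ J₁ J₂)) : GL (Fin (N₁ + N₂)) (mixedSpace E)) =
        (g' : GL (Fin (N₁ + N₂)) (mixedSpace E)) := by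
      have := congrArg (fun k : unitaryGroupOfForm (conjMixed F E c) (finSum N₁ N₂ (archFormOf E N₁ J₁) (archFormOf E N₂ J₂)) =>
        (k : GL (Fin (N₁ + N₂)) (mixedSpace E))) hu
      exact this
    rw [hu', hg', Subgroup.coe_inclusion, hΦ, coe_unitaryGroupOfFormCongrOfEq_symm_apply]
    rw [← mul_assoc, ← mul_assoc, mul_inv_cancel, one_mul, mul_assoc, mul_inv_cancel, mul_one]

/-- **`Z(γ) ≃ₜ* U(J₁)(E ⊗ ℝ) × U(J₂)(E ⊗ ℝ)` WITH THE FORMULA**: for a frame of `γ` there is an isomorphism of topological groups `e` from the block product onto the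
centraliser with `↑(e u) = archFrameEmbedding T hT u` (continuous injective homomorphism from a σ-compact group onto a closed subgroup of a locally compact group —
the open mapping theorem, ★ `exists_continuousMulEquiv_coe_eq_of_injective`). [cite: Rogawski1990, §3.8 Prop. 3.8.1 (a) p. 27] [cite: HewittRoss1979, Thm. (5.29)] -/
theorem exists_continuousMulEquiv_centralizer_of_frame [NumberField E] (T : GL (Fin (N₁ + N₂)) (mixedSpace E))
    (hT : formCongr (conjMixed F E c) T (archFormOf E (N₁ + N₂) J) = archFormOf E (N₁ + N₂) (finSum N₁ N₂ J₁ J₂)) {a b : mixedSpace E} (hab : IsUnit (a - b))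
    (γ : arch F E c (N₁ + N₂) J)
    (hγ : ((γ : GL (Fin (N₁ + N₂)) (mixedSpace E)) : Matrix (Fin (N₁ + N₂)) (Fin (N₁ + N₂)) (mixedSpace E)) * (T : Matrix (Fin (N₁ + N₂)) (Fin (N₁ + N₂)) (mixedSpace E)) =
      (T : Matrix (Fin (N₁ + N₂)) (Fin (N₁ + N₂)) (mixedSpace E)) * finSum N₁ N₂ (a • (1 : Matrix (Fin N₁) (Fin N₁) (mixedSpace E))) (b • 1)) :
    ∃ e : (arch F E c N₁ J₁ × arch F E c N₂ J₂) ≃ₜ* Subgroup.centralizer ({γ} : Set (arch F E c (N₁ + N₂) J)),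
      ∀ u, ((e u : Subgroup.centralizer ({γ} : Set (arch F E c (N₁ + N₂) J))) : arch F E c (N₁ + N₂) J) = archFrameEmbedding T hT u :=
  exists_continuousMulEquiv_coe_eq_of_injective (archFrameEmbedding T hT) (archFrameEmbedding_injective T hT) (continuous_archFrameEmbedding T hT) _
    (range_archFrameEmbedding_eq_centralizer T hT hab γ hγ) (Set.isClosed_centralizer _)


/-- **THE FRAME MEASURE OF HAAR BLOCKS IS A HAAR MEASURE ON `Z(γ)`**: `map (u ↦ T (u₁ ⊕ᶠ u₂) T⁻¹) (μ₁ ⊗ μ₂)` for Haar `μ₁, μ₂` is the image of the Haar measure `μ₁ ⊗ μ₂`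
under the topological-group isomorphism `U(J₁) × U(J₂) ≃ₜ* Z(γ)` of the frame. [cite: Rogawski1990, §1.7 p. 6; §3.8 Prop. 3.8.1 (a) p. 27] -/
theorem isHaarMeasure_centralizerMeasureOfFrame [NumberField E] (T : GL (Fin (N₁ + N₂)) (mixedSpace E))
    (hT : formCongr (conjMixed F E c) T (archFormOf E (N₁ + N₂) J) = archFormOf E (N₁ + N₂) (finSum N₁ N₂ J₁ J₂)) {a b : mixedSpace E} (hab : IsUnit (a - b))
    (γ : arch F E c (N₁ + N₂) J)
    (hγ : ((γ : GL (Fin (N₁ + N₂)) (mixedSpace E)) : Matrix (Fin (N₁ + N₂)) (Fin (N₁ + N₂)) (mixedSpace E)) * (T : Matrix (Fin (N₁ + N₂)) (Fin (N₁ + N₂)) (mixedSpace E)) =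
      (T : Matrix (Fin (N₁ + N₂)) (Fin (N₁ + N₂)) (mixedSpace E)) * finSum N₁ N₂ (a • (1 : Matrix (Fin N₁) (Fin N₁) (mixedSpace E))) (b • 1))
    [MeasurableSpace (arch F E c N₁ J₁)] [BorelSpace (arch F E c N₁ J₁)] [MeasurableSpace (arch F E c N₂ J₂)] [BorelSpace (arch F E c N₂ J₂)]
    [MeasurableSpace (Subgroup.centralizer ({γ} : Set (arch F E c (N₁ + N₂) J)))] [BorelSpace (Subgroup.centralizer ({γ} : Set (arch F E c (N₁ + N₂) J)))]
    (μ₁ : Measure (arch F E c N₁ J₁)) (μ₂ : Measure (arch F E c N₂ J₂)) [μ₁.IsHaarMeasure] [μ₂.IsHaarMeasure] :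
    (centralizerMeasureOfFrame T hT γ hγ μ₁ μ₂).IsHaarMeasure := by
  obtain ⟨e, he⟩ := exists_continuousMulEquiv_centralizer_of_frame T hT hab γ hγ
  haveI : BorelSpace (arch F E c N₁ J₁ × arch F E c N₂ J₂) := Prod.borelSpace
  haveI : SigmaFinite μ₁ := inferInstance
  haveI : SigmaFinite μ₂ := inferInstance
  haveI : (μ₁.prod μ₂).IsHaarMeasure := inferInstance
  have hfun : (fun u : arch F E c N₁ J₁ × arch F E c N₂ J₂ =>
      (⟨archFrameEmbedding T hT u, archFrameEmbedding_mem_centralizer T hT γ hγ u⟩ : Subgroup.centralizer ({γ} : Set (arch F E c (N₁ + N₂) J)))) = ⇑e :=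
    funext fun u => Subtype.ext (he u).symm
  rw [centralizerMeasureOfFrame_def, hfun]
  exact e.isHaarMeasure_map _

end Frame


/-! ## §2 Block algebra: a unit commuting with a block scalar is a block diagonal of units; eigenvalues of a frame are determined -/

section Algebra

variable {S : Type*} [CommRing S] {N₁ N₂ : ℕ}

/-- `(A ⊕ᶠ B)(C ⊕ᶠ D) = AC ⊕ᶠ BD`. [folklore] -/
private theorem finSum_mul_finSum' (A C : Matrix (Fin N₁) (Fin N₁) S) (B D : Matrix (Fin N₂) (Fin N₂) S) :
    finSum N₁ N₂ A B * finSum N₁ N₂ C D = finSum N₁ N₂ (A * C) (B * D) := by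
  simp only [finSum, Matrix.reindex_apply, Matrix.submatrix_mul_equiv, Matrix.fromBlocks_multiply, Matrix.mul_zero, Matrix.zero_mul,
    add_zero, zero_add]

/-- `⊕ᶠ` is injective in the pair of blocks. [folklore] -/
private theorem finSum_inj' {A C : Matrix (Fin N₁) (Fin N₁) S} {B D : Matrix (Fin N₂) (Fin N₂) S} (h : finSum N₁ N₂ A B = finSum N₁ N₂ C D) :
    A = C ∧ B = D := by
  have h' := (Matrix.reindex finSumFinEquiv finSumFinEquiv).injective h
  rw [Matrix.fromBlocks_inj] at h'
  exact ⟨h'.1, h'.2.2.2⟩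

/-- `1 ⊕ᶠ 1 = 1`. [folklore] -/
private theorem finSum_one_one' : finSum N₁ N₂ (1 : Matrix (Fin N₁) (Fin N₁) S) (1 : Matrix (Fin N₂) (Fin N₂) S) = 1 := by
  simp only [finSum, Matrix.fromBlocks_one, Matrix.reindex_apply, Matrix.submatrix_one_equiv]

/-- **A UNIT commuting with the block scalar `a·1 ⊕ᶠ b·1` (`a − b` a unit) is a block diagonal OF UNITS**: `K = g₁ ⊕ g₂` with `g_i ∈ GL` (★ `eq_finSum_of_commute`
for `K` and for `K⁻¹`, and `⊕ᶠ` reads products blockwise). [cite: Rogawski1990, §3.8 Prop. 3.8.1 (a) p. 27] -/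
theorem exists_eq_reindexGL_blockDiagGL_of_commute {a b : S} (hab : IsUnit (a - b)) (K : GL (Fin (N₁ + N₂)) S)
    (hK : (K : Matrix (Fin (N₁ + N₂)) (Fin (N₁ + N₂)) S) * finSum N₁ N₂ (a • (1 : Matrix (Fin N₁) (Fin N₁) S)) (b • 1) =
      finSum N₁ N₂ (a • (1 : Matrix (Fin N₁) (Fin N₁) S)) (b • 1) * (K : Matrix (Fin (N₁ + N₂)) (Fin (N₁ + N₂)) S)) :
    ∃ g : GL (Fin N₁) S × GL (Fin N₂) S, K = reindexGL finSumFinEquiv (blockDiagGL g) := by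
  set D := finSum N₁ N₂ (a • (1 : Matrix (Fin N₁) (Fin N₁) S)) (b • 1) with hD
  set Km : Matrix (Fin (N₁ + N₂)) (Fin (N₁ + N₂)) S := (K : Matrix (Fin (N₁ + N₂)) (Fin (N₁ + N₂)) S) with hKm
  set Ki : Matrix (Fin (N₁ + N₂)) (Fin (N₁ + N₂)) S := ((K⁻¹ : GL (Fin (N₁ + N₂)) S) : Matrix (Fin (N₁ + N₂)) (Fin (N₁ + N₂)) S) with hKi
  have hKK : Ki * Km = 1 := by rw [hKi, hKm, ← Units.val_mul, inv_mul_cancel, Units.val_one]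
  have hKK' : Km * Ki = 1 := by rw [hKi, hKm, ← Units.val_mul, mul_inv_cancel, Units.val_one]
  have hK' : Ki * D = D * Ki := by
    calc Ki * D = Ki * D * (Km * Ki) := by rw [hKK', Matrix.mul_one]
      _ = Ki * (D * Km) * Ki := by simp only [Matrix.mul_assoc]
      _ = Ki * (Km * D) * Ki := by rw [hK]
      _ = (Ki * Km) * D * Ki := by simp only [Matrix.mul_assoc]
      _ = D * Ki := by rw [hKK, Matrix.one_mul]
  obtain ⟨x₁, x₂, hx⟩ := eq_finSum_of_commute hab Km hK
  obtain ⟨y₁, y₂, hy⟩ := eq_finSum_of_commute hab Ki hK'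
  have h1 : x₁ * y₁ = 1 ∧ x₂ * y₂ = 1 := by
    apply finSum_inj'
    rw [← finSum_mul_finSum', ← hx, ← hy, hKK', finSum_one_one']
  have h2 : y₁ * x₁ = 1 ∧ y₂ * x₂ = 1 := by
    apply finSum_inj'
    rw [← finSum_mul_finSum', ← hx, ← hy, hKK, finSum_one_one']
  refine ⟨(⟨x₁, y₁, h1.1, h2.1⟩, ⟨x₂, y₂, h1.2, h2.2⟩), Units.ext ?_⟩
  rw [coe_reindexGL, coe_blockDiagGL, ← hKm, hx, finSum]

end Algebra

/-! ## §3 Over a field: the eigenvalue pair `(x, y)` of a `(2, 1)`-block scalar is a conjugation invariant -/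

section Field

variable {k : Type*} [Field k]

open Polynomial in
/-- `charpoly (x·1₂ ⊕ᶠ y·1₁) = (X − x)² (X − y)`. [folklore] -/
private theorem charpoly_finSum_smul_one (x y : k) :
    (finSum 2 1 (x • (1 : Matrix (Fin 2) (Fin 2) k)) (y • (1 : Matrix (Fin 1) (Fin 1) k))).charpoly = (X - C x) ^ 2 * (X - C y) := by
  rw [finSum, Matrix.reindex_apply, ← Matrix.reindex_apply, Matrix.charpoly_reindex, Matrix.charpoly_fromBlocks_zero₁₂,
    Matrix.smul_one_eq_diagonal, Matrix.smul_one_eq_diagonal, Matrix.charpoly_diagonal, Matrix.charpoly_diagonal]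
  simp only [Finset.prod_const, Finset.card_univ, Fintype.card_fin, pow_one]

open Polynomial in
/-- **Conjugate `(2, 1)`-block scalars have the same eigenvalue pair**: if `x ≠ y` and `(x·1 ⊕ᶠ y·1) K = K (x′·1 ⊕ᶠ y′·1)` for an invertible `K`, then
`x = x′` and `y = y′` (characteristic polynomials `(X − x)²(X − y) = (X − x′)²(X − y′)` in `k[X]`, a domain) — the linear algebra behind «the centraliser of a
singular semisimple element determines its eigenspace decomposition». [cite: Rogawski1990, §3.8 Prop. 3.8.1 (a) p. 27] -/
theorem eq_of_finSum_smul_one_mul_eq {x y x' y' : k} (hxy : x ≠ y) (K : GL (Fin (2 + 1)) k)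
    (h : finSum 2 1 (x • (1 : Matrix (Fin 2) (Fin 2) k)) (y • (1 : Matrix (Fin 1) (Fin 1) k)) * (K : Matrix (Fin (2 + 1)) (Fin (2 + 1)) k) =
      (K : Matrix (Fin (2 + 1)) (Fin (2 + 1)) k) * finSum 2 1 (x' • (1 : Matrix (Fin 2) (Fin 2) k)) (y' • (1 : Matrix (Fin 1) (Fin 1) k))) :
    x = x' ∧ y = y' := by
  set D := finSum 2 1 (x • (1 : Matrix (Fin 2) (Fin 2) k)) (y • (1 : Matrix (Fin 1) (Fin 1) k)) with hD
  set D' := finSum 2 1 (x' • (1 : Matrix (Fin 2) (Fin 2) k)) (y' • (1 : Matrix (Fin 1) (Fin 1) k)) with hD'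
  -- `D′ = K⁻¹ D K`
  have hKK : ((K⁻¹ : GL (Fin (2 + 1)) k) : Matrix (Fin (2 + 1)) (Fin (2 + 1)) k) * (K : Matrix (Fin (2 + 1)) (Fin (2 + 1)) k) = 1 := by
    rw [← Units.val_mul, inv_mul_cancel, Units.val_one]
  have hD'eq : D' = ((K⁻¹ : GL (Fin (2 + 1)) k) : Matrix (Fin (2 + 1)) (Fin (2 + 1)) k) * D * (K : Matrix (Fin (2 + 1)) (Fin (2 + 1)) k) := by
    rw [Matrix.mul_assoc, h, ← Matrix.mul_assoc, hKK, Matrix.one_mul]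
  have hchar : (X - C x') ^ 2 * (X - C y') = (X - C x) ^ 2 * (X - C y) := by
    rw [← charpoly_finSum_smul_one, ← charpoly_finSum_smul_one, ← hD, ← hD', hD'eq, Matrix.coe_units_inv, Matrix.charpoly_units_conj']
  -- evaluate at `x′`: `(x′ − x)² (x′ − y) = 0`
  have hev := congrArg (Polynomial.eval x') hchar
  simp only [eval_mul, eval_pow, eval_sub, eval_X, eval_C, sub_self, zero_pow two_ne_zero, zero_mul] at hev
  have hx' : x' = x ∨ x' = y := by
    rcases mul_eq_zero.1 hev.symm with h1 | h1
    · exact Or.inl (sub_eq_zero.1 (pow_eq_zero_iff two_ne_zero |>.1 h1))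
    · exact Or.inr (sub_eq_zero.1 h1)
  have hxx : x = x' := by
    rcases hx' with h1 | h1
    · exact h1.symm
    · -- `x′ = y`: cancel one factor `X − y` and evaluate at `y`
      exfalso
      rw [h1] at hchar
      have hc : (X - C y) * ((X - C y) * (X - C y')) = (X - C y) * ((X - C x) ^ 2) := by
        linear_combination hchar
      have hc' := mul_left_cancel₀ (X_sub_C_ne_zero y) hc
      have hev' := congrArg (Polynomial.eval y) hc'
      simp only [eval_mul, eval_pow, eval_sub, eval_X, eval_C, sub_self, zero_mul] at hev'
      exact hxy (sub_eq_zero.1 (pow_eq_zero_iff two_ne_zero |>.1 hev'.symm)).symm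
  refine ⟨hxx, ?_⟩
  rw [← hxx] at hchar
  have hc' := mul_left_cancel₀ (pow_ne_zero 2 (X_sub_C_ne_zero x)) hchar
  have := congrArg (Polynomial.eval y) hc'
  simp only [eval_sub, eval_X, eval_C, sub_self] at this
  exact sub_eq_zero.1 this

end Field

/-! ## §4 CM frames -/

section CM

variable {L : Type} [Field L] [NumberField L] [IsCMField L] {H : Matrix (Fin 3) (Fin 3) L}

/-- The eigenvalue difference of a frame is a unit of `L ⊗ ℝ`. [cite: Rogawski1990, §3.8 Prop. 3.8.1 (a) p. 27] -/
theorem IsSingularArchFrame.isUnit_sub {γ : arch (↥(maximalRealSubfield L)) L (IsCMField.complexConj L) 3 H} {a b : L} {T : GL (Fin 3) (mixedSpace L)}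
    {H_a : Matrix (Fin 2) (Fin 2) L} {H_b : Matrix (Fin 1) (Fin 1) L} (h : IsSingularArchFrame L H γ a b T H_a H_b) :
    IsUnit (mixedEmbedding L a - mixedEmbedding L b) := by
  rw [← map_sub]
  exact (IsUnit.mk0 _ (sub_ne_zero.2 h.1)).map _



omit [NumberField L] [IsCMField L] in
/-- `(H_a ⊕ᶠ H_b)′ = H_a′ ⊕ᶠ H_b′` at sizes `2 + 1 = 3` (★ B2a `archFormOf_finSum`, restated with the literal `3` for rewriting). [folklore] -/
private theorem archFormOf_finSum₂₁ (H_a : Matrix (Fin 2) (Fin 2) L) (H_b : Matrix (Fin 1) (Fin 1) L) :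
    archFormOf L 3 (finSum 2 1 H_a H_b) = finSum 2 1 (archFormOf L 2 H_a) (archFormOf L 1 H_b) :=
  archFormOf_finSum L H_a H_b

/-- A CM field has a complex place. [folklore] -/
private theorem nonempty_isComplex : Nonempty {w : InfinitePlace L // IsComplex w} := by
  obtain ⟨w⟩ := (inferInstance : Nonempty (InfinitePlace L))
  exact ⟨⟨w, isComplex_of_smul_eq (↥(maximalRealSubfield L)) L (IsCMField.complexConj L) (IsCMField.complexConj_ne_one L)
    (complexConj_smul_infinitePlace L w)⟩⟩

/-- Accessor: the congruence equation of a frame. [cite: Rogawski1990, §3.8 Prop. 3.8.1 (a) p. 27] -/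
theorem IsSingularArchFrame.formCongr_eq {γ : arch (↥(maximalRealSubfield L)) L (IsCMField.complexConj L) 3 H} {a b : L} {T : GL (Fin 3) (mixedSpace L)}
    {H_a : Matrix (Fin 2) (Fin 2) L} {H_b : Matrix (Fin 1) (Fin 1) L} (h : IsSingularArchFrame L H γ a b T H_a H_b) :
    formCongr (conjMixed (↥(maximalRealSubfield L)) L (IsCMField.complexConj L)) T (archFormOf L 3 H) = archFormOf L 3 (finSum 2 1 H_a H_b) :=
  h.2.2.2.2.2.1

/-- Accessor: the eigen-equation `γ T = T (a·1 ⊕ᶠ b·1)` of a frame. [cite: Rogawski1990, §3.8 Prop. 3.8.1 (a) p. 27] -/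
theorem IsSingularArchFrame.mul_eq {γ : arch (↥(maximalRealSubfield L)) L (IsCMField.complexConj L) 3 H} {a b : L} {T : GL (Fin 3) (mixedSpace L)}
    {H_a : Matrix (Fin 2) (Fin 2) L} {H_b : Matrix (Fin 1) (Fin 1) L} (h : IsSingularArchFrame L H γ a b T H_a H_b) :
    ((γ : GL (Fin 3) (mixedSpace L)) : Matrix (Fin 3) (Fin 3) (mixedSpace L)) * (T : Matrix (Fin 3) (Fin 3) (mixedSpace L)) =
      (T : Matrix (Fin 3) (Fin 3) (mixedSpace L)) * finSum 2 1 (mixedEmbedding L a • (1 : Matrix (Fin 2) (Fin 2) (mixedSpace L))) (mixedEmbedding L b • 1) :=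
  h.2.2.2.2.2.2

/-- **Two frames of the same `γ` intertwine the block scalars**: `(a·1 ⊕ᶠ b·1)′ (T⁻¹ T′) = (T⁻¹ T′) (a′·1 ⊕ᶠ b′·1)′`. [cite: Rogawski1990, §3.8 Prop. 3.8.1 (a) p. 27] -/
theorem IsSingularArchFrame.finSum_mul_inv_mul {γ : arch (↥(maximalRealSubfield L)) L (IsCMField.complexConj L) 3 H} {a b a' b' : L}
    {T T' : GL (Fin 3) (mixedSpace L)} {H_a H_a' : Matrix (Fin 2) (Fin 2) L} {H_b H_b' : Matrix (Fin 1) (Fin 1) L}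
    (h : IsSingularArchFrame L H γ a b T H_a H_b) (h' : IsSingularArchFrame L H γ a' b' T' H_a' H_b') :
    finSum 2 1 (mixedEmbedding L a • (1 : Matrix (Fin 2) (Fin 2) (mixedSpace L))) (mixedEmbedding L b • 1) *
        ((T⁻¹ * T' : GL (Fin 3) (mixedSpace L)) : Matrix (Fin 3) (Fin 3) (mixedSpace L)) =
      ((T⁻¹ * T' : GL (Fin 3) (mixedSpace L)) : Matrix (Fin 3) (Fin 3) (mixedSpace L)) *
        finSum 2 1 (mixedEmbedding L a' • (1 : Matrix (Fin 2) (Fin 2) (mixedSpace L))) (mixedEmbedding L b' • 1) := by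
  set Tm : Matrix (Fin 3) (Fin 3) (mixedSpace L) := (T : Matrix (Fin 3) (Fin 3) (mixedSpace L)) with hTm
  set Ti : Matrix (Fin 3) (Fin 3) (mixedSpace L) := ((T⁻¹ : GL (Fin 3) (mixedSpace L)) : Matrix (Fin 3) (Fin 3) (mixedSpace L)) with hTi
  set Tm' : Matrix (Fin 3) (Fin 3) (mixedSpace L) := (T' : Matrix (Fin 3) (Fin 3) (mixedSpace L)) with hTm'
  have hTT : Ti * Tm = 1 := by rw [hTi, hTm, ← Units.val_mul, inv_mul_cancel, Units.val_one]
  have hTT' : Tm * Ti = 1 := by rw [hTi, hTm, ← Units.val_mul, mul_inv_cancel, Units.val_one]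
  set D := finSum 2 1 (mixedEmbedding L a • (1 : Matrix (Fin 2) (Fin 2) (mixedSpace L))) (mixedEmbedding L b • 1) with hD
  set D' := finSum 2 1 (mixedEmbedding L a' • (1 : Matrix (Fin 2) (Fin 2) (mixedSpace L))) (mixedEmbedding L b' • 1) with hD'
  set G := ((γ : GL (Fin 3) (mixedSpace L)) : Matrix (Fin 3) (Fin 3) (mixedSpace L)) with hG
  have h1 : G * Tm = Tm * D := h.mul_eq
  have h2 : G * Tm' = Tm' * D' := h'.mul_eq
  -- `D = T⁻¹ γ T`
  have hD1 : D = Ti * G * Tm := by rw [Matrix.mul_assoc, h1, ← Matrix.mul_assoc, hTT, Matrix.one_mul]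
  rw [Units.val_mul, ← hTi, ← hTm', hD1]
  calc Ti * G * Tm * (Ti * Tm') = Ti * G * (Tm * Ti) * Tm' := by simp only [Matrix.mul_assoc]
    _ = Ti * G * Tm' := by rw [hTT', Matrix.mul_one]
    _ = Ti * (Tm' * D') := by rw [Matrix.mul_assoc, h2]
    _ = Ti * Tm' * D' := by rw [Matrix.mul_assoc]

/-- **THE EIGENVALUE PAIR OF A FRAME IS DETERMINED BY `γ`**: two frames of `γ` have `a = a′`, `b = b′` (read at one complex place `w`: the `(2, 1)`-block scalars
`diag(σ_w a, σ_w a, σ_w b)` and `diag(σ_w a′, σ_w a′, σ_w b′)` are conjugate in `GL₃(ℂ)`, `eq_of_finSum_smul_one_mul_eq`, and `σ_w` is injective).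
[cite: Rogawski1990, §3.8 Prop. 3.8.1 (a) p. 27] -/
theorem IsSingularArchFrame.eigen_eq {γ : arch (↥(maximalRealSubfield L)) L (IsCMField.complexConj L) 3 H} {a b a' b' : L}
    {T T' : GL (Fin 3) (mixedSpace L)} {H_a H_a' : Matrix (Fin 2) (Fin 2) L} {H_b H_b' : Matrix (Fin 1) (Fin 1) L}
    (h : IsSingularArchFrame L H γ a b T H_a H_b) (h' : IsSingularArchFrame L H γ a' b' T' H_a' H_b') : a = a' ∧ b = b' := by
  obtain ⟨w⟩ := nonempty_isComplex (L := L)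
  set φ := evalC L w with hφ
  have hφe : ∀ x : L, φ (mixedEmbedding L x) = w.1.embedding x := fun x => by
    rw [hφ, evalC_apply, mixedEmbedding_apply_isComplex]
  have hmapD : ∀ x y : L, (finSum 2 1 (mixedEmbedding L x • (1 : Matrix (Fin 2) (Fin 2) (mixedSpace L))) (mixedEmbedding L y • 1)).map φ =
      finSum 2 1 (w.1.embedding x • (1 : Matrix (Fin 2) (Fin 2) ℂ)) (w.1.embedding y • 1) := by
    intro x y
    rw [finSum_map, Matrix.map_smul' _ _ _ (map_mul φ), Matrix.map_smul' _ _ _ (map_mul φ), Matrix.map_one φ (map_zero φ) (map_one φ),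
      Matrix.map_one φ (map_zero φ) (map_one φ), hφe, hφe]
  have hKu : ((Matrix.GeneralLinearGroup.map φ (T⁻¹ * T') : GL (Fin (2 + 1)) ℂ) : Matrix (Fin (2 + 1)) (Fin (2 + 1)) ℂ) =
      ((T⁻¹ * T' : GL (Fin 3) (mixedSpace L)) : Matrix (Fin 3) (Fin 3) (mixedSpace L)).map φ := rfl
  have hK : finSum 2 1 (w.1.embedding a • (1 : Matrix (Fin 2) (Fin 2) ℂ)) (w.1.embedding b • 1) *
        ((Matrix.GeneralLinearGroup.map φ (T⁻¹ * T') : GL (Fin (2 + 1)) ℂ) : Matrix (Fin (2 + 1)) (Fin (2 + 1)) ℂ) =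
      ((Matrix.GeneralLinearGroup.map φ (T⁻¹ * T') : GL (Fin (2 + 1)) ℂ) : Matrix (Fin (2 + 1)) (Fin (2 + 1)) ℂ) *
        finSum 2 1 (w.1.embedding a' • (1 : Matrix (Fin 2) (Fin 2) ℂ)) (w.1.embedding b' • 1) := by
    rw [← hmapD, ← hmapD, hKu, ← Matrix.map_mul, ← Matrix.map_mul, h.finSum_mul_inv_mul h']
  have hxy : w.1.embedding a ≠ w.1.embedding b := fun e => h.1 (w.1.embedding.injective e)
  obtain ⟨ha, hb⟩ := eq_of_finSum_smul_one_mul_eq hxy (Matrix.GeneralLinearGroup.map φ (T⁻¹ * T')) hK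
  exact ⟨w.1.embedding.injective ha, w.1.embedding.injective hb⟩

/-- **TWO FRAMES DIFFER BY A BLOCK CONGRUENCE**: `T′ = T (g₁ ⊕ g₂)` with `g₁ ∈ GL₂(L ⊗ ℝ)`, `g₂ ∈ GL₁(L ⊗ ℝ)` and `σ(g₁)ᵀ H_a′ g₁ = H_{a′}′`, `σ(g₂)ᵀ H_b′ g₂ = H_{b′}′`
(`K = T⁻¹ T′` commutes with the block scalar since the eigenvalue pairs agree, so `K` is a block diagonal of units, `exists_eq_reindexGL_blockDiagGL_of_commute`; the form
equation reads blockwise, ★ `formCongr_mul_eq`, ★ `formCongr_reindexGL_blockDiagGL_finSum`). [cite: Rogawski1990, §3.8 Prop. 3.8.1 (a) p. 27] [cite: PlatonovRapinchuk1994, §2.3] -/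
theorem IsSingularArchFrame.exists_blocks {γ : arch (↥(maximalRealSubfield L)) L (IsCMField.complexConj L) 3 H} {a b a' b' : L}
    {T T' : GL (Fin 3) (mixedSpace L)} {H_a H_a' : Matrix (Fin 2) (Fin 2) L} {H_b H_b' : Matrix (Fin 1) (Fin 1) L}
    (h : IsSingularArchFrame L H γ a b T H_a H_b) (h' : IsSingularArchFrame L H γ a' b' T' H_a' H_b') :
    ∃ g : GL (Fin 2) (mixedSpace L) × GL (Fin 1) (mixedSpace L), T' = T * reindexGL finSumFinEquiv (blockDiagGL g) ∧
      formCongr (conjMixed (↥(maximalRealSubfield L)) L (IsCMField.complexConj L)) g.1 (archFormOf L 2 H_a) = archFormOf L 2 H_a' ∧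
      formCongr (conjMixed (↥(maximalRealSubfield L)) L (IsCMField.complexConj L)) g.2 (archFormOf L 1 H_b) = archFormOf L 1 H_b' := by
  obtain ⟨ha, hb⟩ := h.eigen_eq h'
  have hK := h.finSum_mul_inv_mul h'
  rw [← ha, ← hb] at hK
  obtain ⟨⟨g₁, g₂⟩, hg⟩ := exists_eq_reindexGL_blockDiagGL_of_commute (N₁ := 2) (N₂ := 1) h.isUnit_sub (T⁻¹ * T') hK.symm
  have hT' : T' = T * reindexGL finSumFinEquiv (blockDiagGL (g₁, g₂)) := by rw [← hg, mul_inv_cancel_left]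
  refine ⟨(g₁, g₂), hT', ?_⟩
  have hF := h'.formCongr_eq
  rw [hT', formCongr_mul_eq, h.formCongr_eq, archFormOf_finSum₂₁, archFormOf_finSum₂₁, formCongr_reindexGL_blockDiagGL_finSum] at hF
  exact finSum_inj' hF

/-- Off the frames the definition is the junk `0`. [cite: Rogawski1990, §3.8 Prop. 3.8.1 (a) p. 27] -/
theorem centralizerTopFormHaar_of_not_exists (γ : arch (↥(maximalRealSubfield L)) L (IsCMField.complexConj L) 3 H)
    [MeasurableSpace (Subgroup.centralizer ({γ} : Set (arch (↥(maximalRealSubfield L)) L (IsCMField.complexConj L) 3 H)))]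
    (h : ¬ ∃ (a b : L) (T : GL (Fin 3) (mixedSpace L)) (H_a : Matrix (Fin 2) (Fin 2) L) (H_b : Matrix (Fin 1) (Fin 1) L), IsSingularArchFrame L H γ a b T H_a H_b) :
    centralizerTopFormHaar L H γ = 0 := by
  rw [centralizerTopFormHaar, dif_neg h]


/-- **Block-conjugate frames have block-conjugate embeddings**: `(T (g₁ ⊕ g₂)) (u₁ ⊕ u₂) (T (g₁ ⊕ g₂))⁻¹ = T ((g₁ u₁ g₁⁻¹) ⊕ (g₂ u₂ g₂⁻¹)) T⁻¹`, i.e. the frame embedding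
of `T′ = T (g₁ ⊕ g₂)` is the frame embedding of `T` precomposed with the block congruences `Φ_{g₁} × Φ_{g₂}`. [cite: Rogawski1990, §3.8 Prop. 3.8.1 (a) p. 27] -/
theorem archFrameEmbedding_mul_blockDiag {H_a H_a' : Matrix (Fin 2) (Fin 2) L} {H_b H_b' : Matrix (Fin 1) (Fin 1) L} (T : GL (Fin 3) (mixedSpace L))
    (hT : formCongr (conjMixed (↥(maximalRealSubfield L)) L (IsCMField.complexConj L)) T (archFormOf L 3 H) = archFormOf L 3 (finSum 2 1 H_a H_b))
    (g₁ : GL (Fin 2) (mixedSpace L)) (g₂ : GL (Fin 1) (mixedSpace L))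
    (hT' : formCongr (conjMixed (↥(maximalRealSubfield L)) L (IsCMField.complexConj L)) (T * reindexGL finSumFinEquiv (blockDiagGL (g₁, g₂))) (archFormOf L 3 H) =
      archFormOf L 3 (finSum 2 1 H_a' H_b'))
    (hg₁ : formCongr (conjMixed (↥(maximalRealSubfield L)) L (IsCMField.complexConj L)) g₁ (archFormOf L 2 H_a) = archFormOf L 2 H_a')
    (hg₂ : formCongr (conjMixed (↥(maximalRealSubfield L)) L (IsCMField.complexConj L)) g₂ (archFormOf L 1 H_b) = archFormOf L 1 H_b')
    (u : arch (↥(maximalRealSubfield L)) L (IsCMField.complexConj L) 2 H_a' × arch (↥(maximalRealSubfield L)) L (IsCMField.complexConj L) 1 H_b') :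
    archFrameEmbedding (N₁ := 2) (N₂ := 1) (T * reindexGL finSumFinEquiv (blockDiagGL (g₁, g₂))) hT' u =
      archFrameEmbedding (N₁ := 2) (N₂ := 1) T hT
        ((unitaryGroupOfFormCongrOfEq (conjMixed (↥(maximalRealSubfield L)) L (IsCMField.complexConj L)) g₁ (archFormOf L 2 H_a) (archFormOf L 2 H_a') hg₁ :
            arch (↥(maximalRealSubfield L)) L (IsCMField.complexConj L) 2 H_a' ≃ₜ* arch (↥(maximalRealSubfield L)) L (IsCMField.complexConj L) 2 H_a) u.1,
          (unitaryGroupOfFormCongrOfEq (conjMixed (↥(maximalRealSubfield L)) L (IsCMField.complexConj L)) g₂ (archFormOf L 1 H_b) (archFormOf L 1 H_b') hg₂ :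
            arch (↥(maximalRealSubfield L)) L (IsCMField.complexConj L) 1 H_b' ≃ₜ* arch (↥(maximalRealSubfield L)) L (IsCMField.complexConj L) 1 H_b) u.2) := by
  apply Subtype.ext
  rw [coe_archFrameEmbedding, coe_archFrameEmbedding, coe_archBlockDiag, coe_archBlockDiag, coe_unitaryGroupOfFormCongrOfEq_apply,
    coe_unitaryGroupOfFormCongrOfEq_apply]
  have hp : ((g₁ * (u.1 : GL (Fin 2) (mixedSpace L)) * g₁⁻¹, g₂ * (u.2 : GL (Fin 1) (mixedSpace L)) * g₂⁻¹) : GL (Fin 2) (mixedSpace L) × GL (Fin 1) (mixedSpace L)) =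
      (g₁, g₂) * ((u.1 : GL (Fin 2) (mixedSpace L)), (u.2 : GL (Fin 1) (mixedSpace L))) * (g₁, g₂)⁻¹ := rfl
  rw [hp, map_mul, map_mul, map_inv, map_mul, map_mul, map_inv, mul_inv_rev]
  simp only [mul_assoc]

/-- **FRAME INDEPENDENCE OF THE FRAME MEASURE**: two singular archimedean frames of the same `γ` give the SAME measure on `Z(γ)` from the top-form block measures —
`T′ = T (g₁ ⊕ g₂)` (`exists_blocks`), the embeddings differ by the block congruences `Φ_{g₁} × Φ_{g₂}` (`archFrameEmbedding_mul_blockDiag`), and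
`(Φ_{g_i})_* archTopFormHaar H_{i}′ = archTopFormHaar H_i` (★ `map_archCongr_archTopFormHaar_of_isCM`); Mathlib `Measure.map_prod_map`.  This is print's «compatible measures» being
WELL DEFINED on `G_γ(ℝ)`. [cite: Rogawski1990, §1.7 p. 6; §3.8 Prop. 3.8.1 (a) p. 27] [cite: Helgason2000, Ch. I §1 Thm. 1.14 p. 96] -/
theorem centralizerMeasureOfFrame_eq_of_isSingularArchFrame {γ : arch (↥(maximalRealSubfield L)) L (IsCMField.complexConj L) 3 H} {a b a' b' : L}
    {T T' : GL (Fin 3) (mixedSpace L)} {H_a H_a' : Matrix (Fin 2) (Fin 2) L} {H_b H_b' : Matrix (Fin 1) (Fin 1) L}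
    (h : IsSingularArchFrame L H γ a b T H_a H_b) (h' : IsSingularArchFrame L H γ a' b' T' H_a' H_b')
    [MeasurableSpace (Subgroup.centralizer ({γ} : Set (arch (↥(maximalRealSubfield L)) L (IsCMField.complexConj L) 3 H)))]
    [BorelSpace (Subgroup.centralizer ({γ} : Set (arch (↥(maximalRealSubfield L)) L (IsCMField.complexConj L) 3 H)))]
    [MeasurableSpace (arch (↥(maximalRealSubfield L)) L (IsCMField.complexConj L) 2 H_a)] [BorelSpace (arch (↥(maximalRealSubfield L)) L (IsCMField.complexConj L) 2 H_a)]
    [MeasurableSpace (archSkew (↥(maximalRealSubfield L)) L (IsCMField.complexConj L) 2 H_a)] [BorelSpace (archSkew (↥(maximalRealSubfield L)) L (IsCMField.complexConj L) 2 H_a)]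
    [MeasurableSpace (arch (↥(maximalRealSubfield L)) L (IsCMField.complexConj L) 1 H_b)] [BorelSpace (arch (↥(maximalRealSubfield L)) L (IsCMField.complexConj L) 1 H_b)]
    [MeasurableSpace (archSkew (↥(maximalRealSubfield L)) L (IsCMField.complexConj L) 1 H_b)] [BorelSpace (archSkew (↥(maximalRealSubfield L)) L (IsCMField.complexConj L) 1 H_b)]
    [MeasurableSpace (arch (↥(maximalRealSubfield L)) L (IsCMField.complexConj L) 2 H_a')] [BorelSpace (arch (↥(maximalRealSubfield L)) L (IsCMField.complexConj L) 2 H_a')]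
    [MeasurableSpace (archSkew (↥(maximalRealSubfield L)) L (IsCMField.complexConj L) 2 H_a')] [BorelSpace (archSkew (↥(maximalRealSubfield L)) L (IsCMField.complexConj L) 2 H_a')]
    [MeasurableSpace (arch (↥(maximalRealSubfield L)) L (IsCMField.complexConj L) 1 H_b')] [BorelSpace (arch (↥(maximalRealSubfield L)) L (IsCMField.complexConj L) 1 H_b')]
    [MeasurableSpace (archSkew (↥(maximalRealSubfield L)) L (IsCMField.complexConj L) 1 H_b')] [BorelSpace (archSkew (↥(maximalRealSubfield L)) L (IsCMField.complexConj L) 1 H_b')] :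
    centralizerMeasureOfFrame (N₁ := 2) (N₂ := 1) T h.formCongr_eq γ h.mul_eq (archTopFormHaar (↥(maximalRealSubfield L)) L (IsCMField.complexConj L) 2 H_a)
        (archTopFormHaar (↥(maximalRealSubfield L)) L (IsCMField.complexConj L) 1 H_b) =
      centralizerMeasureOfFrame (N₁ := 2) (N₂ := 1) T' h'.formCongr_eq γ h'.mul_eq (archTopFormHaar (↥(maximalRealSubfield L)) L (IsCMField.complexConj L) 2 H_a')
        (archTopFormHaar (↥(maximalRealSubfield L)) L (IsCMField.complexConj L) 1 H_b') := by
  obtain ⟨⟨g₁, g₂⟩, hT', hg₁, hg₂⟩ := h.exists_blocks h'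
  subst hT'
  have hc := IsCMField.complexConj_ne_one L
  have hfix := complexConj_smul_infinitePlace L
  set Φ₁ : arch (↥(maximalRealSubfield L)) L (IsCMField.complexConj L) 2 H_a' ≃ₜ* arch (↥(maximalRealSubfield L)) L (IsCMField.complexConj L) 2 H_a :=
    unitaryGroupOfFormCongrOfEq (conjMixed (↥(maximalRealSubfield L)) L (IsCMField.complexConj L)) g₁ (archFormOf L 2 H_a) (archFormOf L 2 H_a') hg₁ with hΦ₁
  set Φ₂ : arch (↥(maximalRealSubfield L)) L (IsCMField.complexConj L) 1 H_b' ≃ₜ* arch (↥(maximalRealSubfield L)) L (IsCMField.complexConj L) 1 H_b :=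
    unitaryGroupOfFormCongrOfEq (conjMixed (↥(maximalRealSubfield L)) L (IsCMField.complexConj L)) g₂ (archFormOf L 1 H_b) (archFormOf L 1 H_b') hg₂ with hΦ₂
  have hmap₁ : Measure.map Φ₁ (archTopFormHaar (↥(maximalRealSubfield L)) L (IsCMField.complexConj L) 2 H_a') =
      archTopFormHaar (↥(maximalRealSubfield L)) L (IsCMField.complexConj L) 2 H_a :=
    map_archCongr_archTopFormHaar_of_isCM hc hfix h.2.1 h.2.2.2.1 hg₁
  have hmap₂ : Measure.map Φ₂ (archTopFormHaar (↥(maximalRealSubfield L)) L (IsCMField.complexConj L) 1 H_b') =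
      archTopFormHaar (↥(maximalRealSubfield L)) L (IsCMField.complexConj L) 1 H_b :=
    map_archCongr_archTopFormHaar_of_isCM hc hfix h.2.2.1 h.2.2.2.2.1 hg₂
  haveI : BorelSpace (arch (↥(maximalRealSubfield L)) L (IsCMField.complexConj L) 2 H_a × arch (↥(maximalRealSubfield L)) L (IsCMField.complexConj L) 1 H_b) :=
    Prod.borelSpace
  haveI : BorelSpace (arch (↥(maximalRealSubfield L)) L (IsCMField.complexConj L) 2 H_a' × arch (↥(maximalRealSubfield L)) L (IsCMField.complexConj L) 1 H_b') :=
    Prod.borelSpace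
  haveI := isHaarMeasure_archTopFormHaar_of_isCM H_a' hc hfix h'.2.1 h'.2.2.2.1
  haveI := isHaarMeasure_archTopFormHaar_of_isCM H_b' hc hfix h'.2.2.1 h'.2.2.2.2.1
  haveI : SigmaFinite (archTopFormHaar (↥(maximalRealSubfield L)) L (IsCMField.complexConj L) 2 H_a') := inferInstance
  haveI : SigmaFinite (archTopFormHaar (↥(maximalRealSubfield L)) L (IsCMField.complexConj L) 1 H_b') := inferInstance
  have hfun : (fun u' : arch (↥(maximalRealSubfield L)) L (IsCMField.complexConj L) 2 H_a' × arch (↥(maximalRealSubfield L)) L (IsCMField.complexConj L) 1 H_b' =>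
      (⟨archFrameEmbedding (N₁ := 2) (N₂ := 1) (T * reindexGL finSumFinEquiv (blockDiagGL (g₁, g₂))) h'.formCongr_eq u',
        archFrameEmbedding_mem_centralizer (N₁ := 2) (N₂ := 1) (T * reindexGL finSumFinEquiv (blockDiagGL (g₁, g₂))) h'.formCongr_eq γ h'.mul_eq u'⟩ :
        Subgroup.centralizer ({γ} : Set (arch (↥(maximalRealSubfield L)) L (IsCMField.complexConj L) 3 H)))) =
      (fun u : arch (↥(maximalRealSubfield L)) L (IsCMField.complexConj L) 2 H_a × arch (↥(maximalRealSubfield L)) L (IsCMField.complexConj L) 1 H_b =>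
        (⟨archFrameEmbedding (N₁ := 2) (N₂ := 1) T h.formCongr_eq u, archFrameEmbedding_mem_centralizer (N₁ := 2) (N₂ := 1) T h.formCongr_eq γ h.mul_eq u⟩ :
          Subgroup.centralizer ({γ} : Set (arch (↥(maximalRealSubfield L)) L (IsCMField.complexConj L) 3 H)))) ∘ Prod.map Φ₁ Φ₂ := by
    funext u'
    exact Subtype.ext (archFrameEmbedding_mul_blockDiag T h.formCongr_eq g₁ g₂ h'.formCongr_eq hg₁ hg₂ u')
  have hmeas : Measurable (fun u : arch (↥(maximalRealSubfield L)) L (IsCMField.complexConj L) 2 H_a × arch (↥(maximalRealSubfield L)) L (IsCMField.complexConj L) 1 H_b =>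
      (⟨archFrameEmbedding (N₁ := 2) (N₂ := 1) T h.formCongr_eq u, archFrameEmbedding_mem_centralizer (N₁ := 2) (N₂ := 1) T h.formCongr_eq γ h.mul_eq u⟩ :
        Subgroup.centralizer ({γ} : Set (arch (↥(maximalRealSubfield L)) L (IsCMField.complexConj L) 3 H)))) :=
    ((continuous_archFrameEmbedding (N₁ := 2) (N₂ := 1) T h.formCongr_eq).subtype_mk _).measurable
  have hΦ₁m : Measurable (⇑Φ₁ : arch (↥(maximalRealSubfield L)) L (IsCMField.complexConj L) 2 H_a' → arch (↥(maximalRealSubfield L)) L (IsCMField.complexConj L) 2 H_a) :=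
    Φ₁.continuous.measurable
  have hΦ₂m : Measurable (⇑Φ₂ : arch (↥(maximalRealSubfield L)) L (IsCMField.complexConj L) 1 H_b' → arch (↥(maximalRealSubfield L)) L (IsCMField.complexConj L) 1 H_b) :=
    Φ₂.continuous.measurable
  have hΦmeas : Measurable (Prod.map Φ₁ Φ₂) := hΦ₁m.prodMap hΦ₂m
  rw [centralizerMeasureOfFrame_def, centralizerMeasureOfFrame_def, hfun, ← Measure.map_map hmeas hΦmeas, ← Measure.map_prod_map _ _ hΦ₁m hΦ₂m, hmap₁, hmap₂]

/-- **`centralizerTopFormHaar γ` IS THE FRAME MEASURE OF EVERY FRAME**: for any singular archimedean frame `(a′, b′, T′, H_{a′}, H_{b′})` of `γ`,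
`centralizerTopFormHaar L H γ = centralizerMeasureOfFrame T′ … (archTopFormHaar H_{a′}) (archTopFormHaar H_{b′})` — the definition's choice of frame is immaterial
(`centralizerMeasureOfFrame_eq_of_isSingularArchFrame`).  With ★ `isHaarMeasure_centralizerMeasureOfFrame` this makes `centralizerTopFormHaar γ` a Haar measure on `Z(γ)` computed in
any frame the consumer holds (e.g. the rational frame of ★ `exists_singular_frame_of_isSemisimpleElt`). [cite: Rogawski1990, §1.7 p. 6; §3.8 Prop. 3.8.1 (a) p. 27] -/
theorem centralizerTopFormHaar_eq_centralizerMeasureOfFrame {γ : arch (↥(maximalRealSubfield L)) L (IsCMField.complexConj L) 3 H} {a' b' : L}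
    {T' : GL (Fin 3) (mixedSpace L)} {H_a' : Matrix (Fin 2) (Fin 2) L} {H_b' : Matrix (Fin 1) (Fin 1) L} (h' : IsSingularArchFrame L H γ a' b' T' H_a' H_b')
    [MeasurableSpace (Subgroup.centralizer ({γ} : Set (arch (↥(maximalRealSubfield L)) L (IsCMField.complexConj L) 3 H)))]
    [BorelSpace (Subgroup.centralizer ({γ} : Set (arch (↥(maximalRealSubfield L)) L (IsCMField.complexConj L) 3 H)))]
    [MeasurableSpace (arch (↥(maximalRealSubfield L)) L (IsCMField.complexConj L) 2 H_a')] [BorelSpace (arch (↥(maximalRealSubfield L)) L (IsCMField.complexConj L) 2 H_a')]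
    [MeasurableSpace (archSkew (↥(maximalRealSubfield L)) L (IsCMField.complexConj L) 2 H_a')] [BorelSpace (archSkew (↥(maximalRealSubfield L)) L (IsCMField.complexConj L) 2 H_a')]
    [MeasurableSpace (arch (↥(maximalRealSubfield L)) L (IsCMField.complexConj L) 1 H_b')] [BorelSpace (arch (↥(maximalRealSubfield L)) L (IsCMField.complexConj L) 1 H_b')]
    [MeasurableSpace (archSkew (↥(maximalRealSubfield L)) L (IsCMField.complexConj L) 1 H_b')] [BorelSpace (archSkew (↥(maximalRealSubfield L)) L (IsCMField.complexConj L) 1 H_b')] :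
    centralizerTopFormHaar L H γ =
      centralizerMeasureOfFrame (N₁ := 2) (N₂ := 1) T' h'.formCongr_eq γ h'.mul_eq (archTopFormHaar (↥(maximalRealSubfield L)) L (IsCMField.complexConj L) 2 H_a')
        (archTopFormHaar (↥(maximalRealSubfield L)) L (IsCMField.complexConj L) 1 H_b') := by
  have hex : ∃ (a b : L) (T : GL (Fin 3) (mixedSpace L)) (H_a : Matrix (Fin 2) (Fin 2) L) (H_b : Matrix (Fin 1) (Fin 1) L), IsSingularArchFrame L H γ a b T H_a H_b :=
    ⟨_, _, _, _, _, h'⟩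
  rw [centralizerTopFormHaar, dif_pos hex]
  letI : MeasurableSpace (arch (↥(maximalRealSubfield L)) L (IsCMField.complexConj L) 2 hex.choose_spec.choose_spec.choose_spec.choose) := borel _
  haveI : BorelSpace (arch (↥(maximalRealSubfield L)) L (IsCMField.complexConj L) 2 hex.choose_spec.choose_spec.choose_spec.choose) := ⟨rfl⟩
  letI : MeasurableSpace (archSkew (↥(maximalRealSubfield L)) L (IsCMField.complexConj L) 2 hex.choose_spec.choose_spec.choose_spec.choose) := borel _
  haveI : BorelSpace (archSkew (↥(maximalRealSubfield L)) L (IsCMField.complexConj L) 2 hex.choose_spec.choose_spec.choose_spec.choose) := ⟨rfl⟩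
  letI : MeasurableSpace (arch (↥(maximalRealSubfield L)) L (IsCMField.complexConj L) 1 hex.choose_spec.choose_spec.choose_spec.choose_spec.choose) := borel _
  haveI : BorelSpace (arch (↥(maximalRealSubfield L)) L (IsCMField.complexConj L) 1 hex.choose_spec.choose_spec.choose_spec.choose_spec.choose) := ⟨rfl⟩
  letI : MeasurableSpace (archSkew (↥(maximalRealSubfield L)) L (IsCMField.complexConj L) 1 hex.choose_spec.choose_spec.choose_spec.choose_spec.choose) := borel _
  haveI : BorelSpace (archSkew (↥(maximalRealSubfield L)) L (IsCMField.complexConj L) 1 hex.choose_spec.choose_spec.choose_spec.choose_spec.choose) := ⟨rfl⟩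
  exact centralizerMeasureOfFrame_eq_of_isSingularArchFrame hex.choose_spec.choose_spec.choose_spec.choose_spec.choose_spec h'

/-- **`centralizerTopFormHaar γ` IS A HAAR MEASURE** on `Z(γ)` whenever `γ` admits a singular archimedean frame. [cite: Rogawski1990, §1.7 p. 6; §3.8 Prop. 3.8.1 (a) p. 27] -/
theorem isHaarMeasure_centralizerTopFormHaar {γ : arch (↥(maximalRealSubfield L)) L (IsCMField.complexConj L) 3 H} {a' b' : L}
    {T' : GL (Fin 3) (mixedSpace L)} {H_a' : Matrix (Fin 2) (Fin 2) L} {H_b' : Matrix (Fin 1) (Fin 1) L} (h' : IsSingularArchFrame L H γ a' b' T' H_a' H_b')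
    [MeasurableSpace (Subgroup.centralizer ({γ} : Set (arch (↥(maximalRealSubfield L)) L (IsCMField.complexConj L) 3 H)))]
    [BorelSpace (Subgroup.centralizer ({γ} : Set (arch (↥(maximalRealSubfield L)) L (IsCMField.complexConj L) 3 H)))] :
    (centralizerTopFormHaar L H γ).IsHaarMeasure := by
  letI : MeasurableSpace (arch (↥(maximalRealSubfield L)) L (IsCMField.complexConj L) 2 H_a') := borel _
  haveI : BorelSpace (arch (↥(maximalRealSubfield L)) L (IsCMField.complexConj L) 2 H_a') := ⟨rfl⟩
  letI : MeasurableSpace (archSkew (↥(maximalRealSubfield L)) L (IsCMField.complexConj L) 2 H_a') := borel _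
  haveI : BorelSpace (archSkew (↥(maximalRealSubfield L)) L (IsCMField.complexConj L) 2 H_a') := ⟨rfl⟩
  letI : MeasurableSpace (arch (↥(maximalRealSubfield L)) L (IsCMField.complexConj L) 1 H_b') := borel _
  haveI : BorelSpace (arch (↥(maximalRealSubfield L)) L (IsCMField.complexConj L) 1 H_b') := ⟨rfl⟩
  letI : MeasurableSpace (archSkew (↥(maximalRealSubfield L)) L (IsCMField.complexConj L) 1 H_b') := borel _
  haveI : BorelSpace (archSkew (↥(maximalRealSubfield L)) L (IsCMField.complexConj L) 1 H_b') := ⟨rfl⟩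
  haveI := isHaarMeasure_archTopFormHaar_of_isCM H_a' (IsCMField.complexConj_ne_one L) (complexConj_smul_infinitePlace L) h'.2.1 h'.2.2.2.1
  haveI := isHaarMeasure_archTopFormHaar_of_isCM H_b' (IsCMField.complexConj_ne_one L) (complexConj_smul_infinitePlace L) h'.2.2.1 h'.2.2.2.2.1
  rw [centralizerTopFormHaar_eq_centralizerMeasureOfFrame h']
  exact isHaarMeasure_centralizerMeasureOfFrame (N₁ := 2) (N₂ := 1) T' h'.formCongr_eq h'.isUnit_sub γ h'.mul_eq _ _

end CM

end UnitaryArchTopForm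

end Literature.NumberTheory.Weil1964

end
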